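import Summits.RiemannHypothesis.RiemannHypothesis.Theorems.ScrewManifestCurvature
import Summits.RiemannHypothesis.RiemannHypothesis.Theorems.ZetaScrewCuspExpansion
import Mathlib.Analysis.Real.Pi.Bounds
import HarnessLib

/-!
# RH-FREE preliminaries for the assembly `CuspBound → CornerGap → LagDensity → CornerCostLaw`

Two bookkeeping facts used by the ASSEMBLY step of sos-theory's reduction of `CornerCostLaw` (S1 of
`ScrewManifestCornerLaw`) to the slots of `ScrewManifestCornerGap` (note SCREW-P3-FOLD-NOTE-g19 §2):

* `remainder_offdiag_eq` — in every manifest remainder the all-ones weight CANCELS between an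
  off-diagonal entry and the two diagonal ones:
  `R i j = (R i i + R j j)/2 − η(node i − node j)`, `η = remainderFn` (the profile function of
  `ScrewManifestCurvature`).  So a near entry is the cusp defect `−η(lag)` up to the (small) diagonals.
* `abs_mul_zetaScrew_div_sub_le` — the UNIFORM scaled cusp ("Consequence" of L1 in the note):
  `|M·Ψ(s/M) − (s/2)·log M| ≤ 15` for `1 ≤ s ≤ 3`, `M ≥ 6`, from the tree's cusp expansion
  `ZetaScrewCuspExpansion.abs_zetaScrew_sub_cusp_le` and `|(1 − γ₀ − log 2π)/2| ≤ 1`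
  (`abs_cuspConst_le_one`).

RH-FREE: statements about the certificate FORMAT and the archimedean part of Suzuki2023 (1.1) near `0`;
nothing here bears on the truth of RH.  References: M. Suzuki, J. Lond. Math. Soc. (2) 108 (2023)
[Suzuki2023]; [folklore].
-/

set_option linter.dupNamespace false
set_option autoImplicit false

noncomputable section

open Real Set

namespace Summit.RiemannHypothesis.RiemannHypothesis.Theorems.IntegerScrew.Manifest

open Literature.NumberTheory.LFunctions

/-- **The all-ones weight cancels**: `R i j = (R i i + R j j)/2 − η(node i − node j)` for the manifest
remainder `R = remainder n K t w wJ` and its profile `η = remainderFn K t w`. [folklore] -/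
theorem remainder_offdiag_eq (n K : ℕ) (t w : Fin K → ℝ) (wJ : ℝ) (i j : Fin n) :
    remainder n K t w wJ i j
      = (remainder n K t w wJ i i + remainder n K t w wJ j j) / 2
        - remainderFn K t w (node n i - node n j) := by
  rw [remainder_apply_remainderFn, remainder_apply_remainderFn n K t w wJ i i,
    remainder_apply_remainderFn n K t w wJ j j, sub_self, sub_self, remainderFn_zero]
  ring

/-- The cusp constant is at most one in size: `|(1 − γ₀ − log 2π)/2| ≤ 1`
(`1/2 < γ₀ < 2/3`, `0 ≤ log 2π < 2`). [folklore] -/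
theorem abs_cuspConst_le_one :
    |(1 - Real.eulerMascheroniConstant - Real.log (2 * Real.pi)) / 2| ≤ 1 := by
  have hγ1 := Real.one_half_lt_eulerMascheroniConstant
  have hγ2 := Real.eulerMascheroniConstant_lt_two_thirds
  have hπ := Real.pi_lt_d2
  have hπ0 := Real.pi_pos
  have hlog0 : 0 ≤ Real.log (2 * Real.pi) := Real.log_nonneg (by linarith [Real.pi_gt_three])
  have hlog2 : Real.log (2 * Real.pi) < 2 := by
    have he := Real.exp_one_gt_d9
    have h2 : 2 * Real.pi < Real.exp 2 := by
      have e : Real.exp 2 = Real.exp 1 * Real.exp 1 := by rw [← Real.exp_add]; norm_num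
      rw [e]; nlinarith
    have := Real.log_lt_log (by positivity) h2
    rwa [Real.log_exp] at this
  rw [abs_le]
  constructor
  · linarith
  · linarith

/-- **Uniform scaled cusp.** For `1 ≤ s ≤ 3` and `M ≥ 6`: `|M·Ψ(s/M) − (s/2)·log M| ≤ 15`
(from `|Ψ(t) − ((t/2)log(1/t) + c·t)| ≤ 6t²` at `t = s/M ≤ 1/2`, `(s/2)|log s| ≤ 3`, `|c|·s ≤ 3`,
`6s²/M ≤ 9`). [folklore] -/
theorem abs_mul_zetaScrew_div_sub_le {s M : ℝ} (hs1 : 1 ≤ s) (hs3 : s ≤ 3) (hM : 6 ≤ M) :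
    |M * zetaScrew (s / M) - s / 2 * Real.log M| ≤ 15 := by
  have hM0 : 0 < M := by linarith
  have hs0 : 0 < s := by linarith
  have ht0 : 0 < s / M := by positivity
  have ht2 : s / M ≤ 1 / 2 := by
    rw [div_le_div_iff₀ hM0 (by norm_num)]; linarith
  set c := (1 - Real.eulerMascheroniConstant - Real.log (2 * Real.pi)) / 2 with hc
  have hcusp := abs_zetaScrew_sub_cusp_le ht0 ht2
  rw [← hc] at hcusp
  have hcabs : |c| ≤ 1 := abs_cuspConst_le_one
  -- `log(1/(s/M)) = log M − log s`
  have hlog : Real.log (1 / (s / M)) = Real.log M - Real.log s := by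
    rw [one_div, Real.log_inv, Real.log_div hs0.ne' hM0.ne']; ring
  rw [hlog] at hcusp
  -- multiply the cusp bound by `M`
  have hmul : |M * zetaScrew (s / M) - (s / 2 * (Real.log M - Real.log s) + c * s)|
      ≤ 6 * s ^ 2 / M := by
    have e : M * zetaScrew (s / M) - (s / 2 * (Real.log M - Real.log s) + c * s)
        = M * (zetaScrew (s / M) - (s / M / 2 * (Real.log M - Real.log s) + c * (s / M))) := by
      field_simp
    rw [e, abs_mul, abs_of_pos hM0]
    have h := mul_le_mul_of_nonneg_left hcusp hM0.le
    have e2 : M * (6 * (s / M) ^ 2) = 6 * s ^ 2 / M := by field_simp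
    rw [e2] at h
    exact h
  -- the three bounded pieces
  have h1 : 6 * s ^ 2 / M ≤ 9 := by
    rw [div_le_iff₀ hM0]; nlinarith
  have hlogs0 : 0 ≤ Real.log s := Real.log_nonneg hs1
  have hlogs : Real.log s ≤ 2 := by
    have := Real.log_le_sub_one_of_pos hs0; linarith
  have h2 : |s / 2 * Real.log s| ≤ 3 := by
    rw [abs_of_nonneg (by positivity)]; nlinarith
  have h3 : |c * s| ≤ 3 := by
    rw [abs_mul, abs_of_pos hs0]; nlinarith [abs_nonneg c]
  -- assemble
  have e3 : M * zetaScrew (s / M) - s / 2 * Real.log M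
      = (M * zetaScrew (s / M) - (s / 2 * (Real.log M - Real.log s) + c * s))
        - s / 2 * Real.log s + c * s := by ring
  rw [e3]
  have t1 := abs_add_le ((M * zetaScrew (s / M) - (s / 2 * (Real.log M - Real.log s) + c * s))
      - s / 2 * Real.log s) (c * s)
  have t2 := abs_sub (M * zetaScrew (s / M) - (s / 2 * (Real.log M - Real.log s) + c * s))
      (s / 2 * Real.log s)
  linarith

end Summit.RiemannHypothesis.RiemannHypothesis.Theorems.IntegerScrew.Manifest

end
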